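import Summits.QuantumFields.BalabanUV.T4Continuum.Support.BlockAverageDbarLinBound
import Summits.QuantumFields.BalabanUV.T4Continuum.Support.NE3QbarNearFlat
import HarnessLib

/-!
# NE7PushDirNearFlat — THE LINEARISED BLOCK AVERAGE OF (42) AT A NEAR-IDENTITY BACKGROUND IS BAŁABAN'S `T_c` UP TO `O(link radius + loop radius)·ℓ¹`:
# `‖pushDir L W ψ (q,κ) − Tside L ψ (q,κ)‖ ≤ (64β + 1250w + 2(2d+2)L·b)·(loopL1 + ‖ψ‖_{ℓ¹(Γ_c)})` (lineage `b2b-balaban-t4-ne7-p1`, gen 117, file F1)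

Cell `pub-balaban`, rung (B)+1 sub-cell t4, CRUX PROVER NE7 #1 (OWNER of row NE7), generation 117; ROAD-G116 §7∕§9 successor item (G1) «a curved commutation letter».
This is the first letter of the COVARIANT CURVED COARSE-CURL LETTER (Bałaban's (48) at a small-field background WITH REMAINDER): the perturbation of the
one-step linearised average `pushDir L W ψ` ([Balaban1985Averaging] (42), tree `AveragingDeficitResidualPairing.pushDir = Ad_{V̄(c)⁻¹} δV̄(c)`) around the flat
background, where it IS `T_c` (✓ `BlockAveragePushDirSplit.pushDir_flat`, (47)–(48)).

WHAT ([folklore] lattice kinematics over the tree's transcriptions; 0 def, 0 sorry):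
* `flatLin_eq_Tside` — the abelian loop identity behind `pushDir_flat`: `Σ_x L^{−d}·ψ(Γ_{c,x} ∪ (−Γ_c)) + ψ(Γ_c) = T_c(ψ)`.
* `norm_sideDerivLin_sub_flat_le` — at a background whose links within `ℓ¹`-distance `(2d+2)L` of `c₋` are within `b` of `1`:
  `‖[Σ_x L^{−d}(δ_ψW)(loop_{c,x}) + (δ_ψW)(Γ_c)] − [Σ_x L^{−d}ψ(loop_{c,x}) + ψ(Γ_c)]‖ ≤ 2(2d+2)L·b·loopL1 + 2L·b·‖ψ‖_{ℓ¹(Γ_c)}` (✓ `norm_dhol_sub_asum_le_of_l1`).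
* **`norm_pushDir_sub_Tside_le`** — for `U(N)` data with loop variables within `w ≤ 1∕32` of `1` at `c`, links within `b` of `1` near `c`, and `‖V̄(c) − 1‖ ≤ β`:
  `‖pushDir L W ψ (q,κ) − Tside L ψ (q,κ)‖ ≤ (64β + 1250w + 2(2d+2)L·b)·(loopL1 L ψ q κ + lnorm ψ q (seg κ L))`
  (✓ `norm_sideDeriv_sub_lin_le` for the `O(w)` nonlinearity of `J_{X_c}` and `e^{X_c}`, ✓ `norm_Ad_sub_le` for the conjugation by `V̄(c)⁻¹`).
* `norm_pushDir_le` (`≤ 32·loopL1 + ‖ψ‖_{ℓ¹(Γ_c)}`) and the BOX forms `loopL1_add_seg_le_box` ∕ `norm_pushDir_sub_Tside_le_box` ∕ `norm_pushDir_le_box` in the currency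
  `dirL1 ψ (box ((2d+2)L) q)` (✓ `AveragingDeficitPlaqLin.lnorm_le_region`).
Consumers (this generation): F2 `NE7CurvedAverageCurlLetter` (the dressed identity `curl_{V̄} ∘ T_W = block average ∘ Ad∘curl_W + O(a)·ℓ¹` via an axial gauge on the block
neighbourhood), F3 `NE7CoarseCurlEnergyCurved` (the one-step coarse Maxwell energy and level-mass letters on the torus).
HONEST FRAMING: lattice kinematics of ONE averaging step at ONE background; nothing of Bałaban's asserted ((42), (47)–(48) p. 23–25 context only); NOT (G′), NOT NE7 as a
spine node, NOT NE3; spine 0∕9; finite T⁴ rung (B)+1 — NOT infinite volume, NOT mass gap, NOT BetaPertH, NOT Clay.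
-/

set_option autoImplicit false

open scoped BigOperators Matrix.Norms.L2Operator
open NormedSpace Finset

namespace Summit.QuantumFields.BalabanUV.T4Continuum.NE7PushDirNearFlat

open Literature.MathematicalPhysics.QuantumFieldTheory.Balaban1983to89
open B7Prop1Explicit B7Prop2Explicit MatrixLog UnitaryModel
open T4AveragingDeficitWall (IsUnitaryCfg Ad dirL1 box)
open AveragingDeficitTransport (dhol lnorm norm_dhol_le norm_Ad_of_unitary mem_U1_of_unitary)
open AveragingDeficitNearIdentity (norm_Ad_sub_le norm_dhol_sub_asum_le_of_l1)
open AveragingDeficitSideDeriv (loopWord length_loopWord sideDeriv sideDerivLin loopAvg norm_sideDeriv_sub_lin_le expUnit_Xavg_mem_unitary)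
open AveragingDeficitResidualPairing (pushDir)
open AveragingDeficitPlaqLin (lnorm_le_region length_loopWord_le)
open AveragingDeficitDerivCore (dirL1_nonneg)
open BlockAveragePushDirSplit (sum_blockWeight_eq_one)
open BlockAverageDbarLinBound (loopL1 lnorm_nonneg)
open NE3QbarNearFlat (norm_asum_le_lnorm)

noncomputable section

variable {d : ℕ} {n : Type*} [Fintype n] [DecidableEq n]

/-! ## §1 The abelian loop identity: `Σ_x L^{−d} ψ(loop_{c,x}) + ψ(Γ_c) = T_c(ψ)` -/

/-- **THE FLAT LINEARISATION IS `T_c`**: `Σ_x L^{−d}·ψ(Γ_{c,x} ∪ (−Γ_c)) + ψ(Γ_c) = Σ_x L^{−d}·ψ(Γ_{c,x}) = T_c(ψ)` (the weights sum to one).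
[cite: Balaban1985Averaging, (47)–(48) p.25] -/
theorem flatLin_eq_Tside {L : ℕ} (hL : 1 ≤ L) (ψ : Site d → Fin d → Matrix n n ℂ) (q : Site d) (κ : Fin d) :
    ∑ r : Fin d → Fin L, (((L : ℝ) ^ d)⁻¹ : ℝ) • asum ψ q (loopWord L κ (boxVec L r)) + asum ψ q (seg κ L) = Tside L ψ q κ := by
  have hloop : ∀ r : Fin d → Fin L,
      asum ψ q (loopWord L κ (boxVec L r)) = asum ψ q (gammaWord L κ (boxVec L r)) - asum ψ q (seg κ L) := by
    intro r
    rw [loopWord, asum_append, disp_gammaWord, asum_seg_neg, add_sub_cancel_right, sub_eq_add_neg]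
  simp only [hloop, smul_sub, Finset.sum_sub_distrib, ← Finset.sum_smul, sum_blockWeight_eq_one L hL, one_smul, sub_add_cancel, Tside]

/-! ## §2 The dressed linearisation against the abelian one: `O(link radius)·ℓ¹` -/

/-- `loopL1 ≥ 0`. [folklore] -/
theorem loopL1_nonneg (L : ℕ) (ψ : Site d → Fin d → Matrix n n ℂ) (q : Site d) (κ : Fin d) : 0 ≤ loopL1 L ψ q κ :=
  Finset.sum_nonneg fun _ _ => mul_nonneg (by positivity) (lnorm_nonneg ψ _ _)

/-- `loopAvg ≤ loopL1` on `U(N)` data (`‖(δ_ψW)(Γ)‖ ≤ Σ_{b⊂Γ}‖ψ(b)‖`). [folklore] -/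
theorem loopAvg_le_loopL1 [Nonempty n] (L : ℕ) {W : Site d → Fin d → (Matrix n n ℂ)ˣ} (hW : IsUnitaryCfg W) (ψ : Site d → Fin d → Matrix n n ℂ)
    (q : Site d) (κ : Fin d) : loopAvg L W ψ q κ ≤ loopL1 L ψ q κ := by
  unfold loopAvg loopL1
  exact Finset.sum_le_sum fun r _ => mul_le_mul_of_nonneg_left (norm_dhol_le hW ψ _ _) (by positivity)

/-- **THE DRESSED LINEARISATION AGAINST THE ABELIAN ONE**: if every link starting within `ℓ¹`-distance `(2d+2)L` of `c₋ = q` is within `b` of `1`, then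
`‖[Σ_x L^{−d}(δ_ψW)(loop_{c,x}) + (δ_ψW)(Γ_c)] − [Σ_x L^{−d}ψ(loop_{c,x}) + ψ(Γ_c)]‖ ≤ 2(2d+2)L·b·loopL1 + 2L·b·‖ψ‖_{ℓ¹(Γ_c)}`. [folklore] -/
theorem norm_sideDerivLin_sub_flat_le [Nonempty n] (L : ℕ) {W : Site d → Fin d → (Matrix n n ℂ)ˣ} (hW : IsUnitaryCfg W)
    (ψ : Site d → Fin d → Matrix n n ℂ) (q : Site d) (κ : Fin d) {b : ℝ} (hb : 0 ≤ b)
    (hWb : ∀ (x : Site d) (μ : Fin d), l1 (x - q) ≤ (2 * d + 2) * L → ‖((W x μ : (Matrix n n ℂ)ˣ) : Matrix n n ℂ) - 1‖ ≤ b) :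
    ‖sideDerivLin L W ψ q κ - (∑ r : Fin d → Fin L, (((L : ℝ) ^ d)⁻¹ : ℝ) • asum ψ q (loopWord L κ (boxVec L r)) + asum ψ q (seg κ L))‖
      ≤ 2 * ((2 * d + 2) * L) * b * loopL1 L ψ q κ + 2 * L * b * lnorm ψ q (seg κ L) := by
  -- loops
  have hloop : ∀ r : Fin d → Fin L,
      ‖dhol W ψ q (loopWord L κ (boxVec L r)) - asum ψ q (loopWord L κ (boxVec L r))‖
        ≤ 2 * ((2 * d + 2) * L) * b * lnorm ψ q (loopWord L κ (boxVec L r)) := by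
    intro r
    have hlen := length_loopWord_le L κ r
    have h := norm_dhol_sub_asum_le_of_l1 hW ψ hb q (loopWord L κ (boxVec L r)) fun x μ hx => hWb x μ (hx.trans hlen)
    refine h.trans ?_
    have hl0 := lnorm_nonneg ψ q (loopWord L κ (boxVec L r))
    have hlen' : ((loopWord L κ (boxVec L r)).length : ℝ) ≤ (2 * d + 2) * L := by exact_mod_cast hlen
    have := mul_le_mul_of_nonneg_right (mul_le_mul_of_nonneg_right (mul_le_mul_of_nonneg_left hlen' (by norm_num : (0:ℝ) ≤ 2)) hb) hl0
    linarith
  -- the straight segment `Γ_c` (length `L ≤ (2d+2)L`)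
  have hseg : ‖dhol W ψ q (seg κ L) - asum ψ q (seg κ L)‖ ≤ 2 * L * b * lnorm ψ q (seg κ L) := by
    have hlen : (seg κ (L : ℤ)).length = L := by rw [length_seg, Int.natAbs_natCast]
    have h := norm_dhol_sub_asum_le_of_l1 hW ψ hb q (seg κ L) fun x μ hx => hWb x μ (by rw [hlen] at hx; nlinarith)
    rw [hlen] at h
    exact h
  -- assemble
  have e1 : sideDerivLin L W ψ q κ - (∑ r : Fin d → Fin L, (((L : ℝ) ^ d)⁻¹ : ℝ) • asum ψ q (loopWord L κ (boxVec L r)) + asum ψ q (seg κ L))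
      = ∑ r : Fin d → Fin L, (((L : ℝ) ^ d)⁻¹ : ℝ) • (dhol W ψ q (loopWord L κ (boxVec L r)) - asum ψ q (loopWord L κ (boxVec L r)))
        + (dhol W ψ q (seg κ L) - asum ψ q (seg κ L)) := by
    simp only [sideDerivLin, smul_sub, Finset.sum_sub_distrib]
    abel
  rw [e1]
  refine (norm_add_le _ _).trans (add_le_add ?_ hseg)
  refine (norm_sum_le _ _).trans ?_
  unfold loopL1
  rw [Finset.mul_sum]
  refine Finset.sum_le_sum fun r _ => ?_
  rw [norm_smul, norm_inv, norm_pow, Real.norm_natCast]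
  have hw0 : (0 : ℝ) ≤ ((L : ℝ) ^ d)⁻¹ := by positivity
  have := mul_le_mul_of_nonneg_left (hloop r) hw0
  refine this.trans (le_of_eq ?_)
  ring

/-! ## §3 `pushDir` against `T_c` -/

/-- The averaged bond variable `V̄(c) = e^{X_c}·W(Γ_c)` is unitary on `U(N)` data whose loop variables at `c` are within `1∕4` of `1`. [folklore] -/
theorem bavg_mem_unitary [Nonempty n] (L : ℕ) {W : Site d → Fin d → (Matrix n n ℂ)ˣ} (hW : IsUnitaryCfg W) (q : Site d) (κ : Fin d)
    (hWw : ∀ r : Fin d → Fin L, ‖((Wcx L W q κ (boxVec L r) : (Matrix n n ℂ)ˣ) : Matrix n n ℂ) - 1‖ ≤ 1 / 4) :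
    bavg L W q κ ∈ unitaryUnits (Matrix n n ℂ) := by
  unfold bavg
  exact (unitaryUnits (Matrix n n ℂ)).mul_mem (expUnit_Xavg_mem_unitary L hW q κ hWw) (hol_mem_of hW _ _)

/-- `‖pushDir L W ψ (q,κ)‖ = ‖δV̄(c)‖ ≤ 32·loopL1 + ‖ψ‖_{ℓ¹(Γ_c)}` (loop variables within `w ≤ 1∕32`). [folklore] -/
theorem norm_pushDir_le [Nonempty n] {L : ℕ} (hL : 1 ≤ L) {W : Site d → Fin d → (Matrix n n ℂ)ˣ} (hW : IsUnitaryCfg W)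
    (ψ : Site d → Fin d → Matrix n n ℂ) (q : Site d) (κ : Fin d) {w : ℝ} (hw : w ≤ 1 / 32)
    (hWw : ∀ r : Fin d → Fin L, ‖((Wcx L W q κ (boxVec L r) : (Matrix n n ℂ)ˣ) : Matrix n n ℂ) - 1‖ ≤ w) :
    ‖pushDir L W ψ q κ‖ ≤ 32 * loopL1 L ψ q κ + lnorm ψ q (seg κ L) := by
  have hW4 : ∀ r : Fin d → Fin L, ‖((Wcx L W q κ (boxVec L r) : (Matrix n n ℂ)ˣ) : Matrix n n ℂ) - 1‖ ≤ 1 / 4 :=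
    fun r => (hWw r).trans (hw.trans (by norm_num))
  have hbu := bavg_mem_unitary L hW q κ hW4
  unfold pushDir
  rw [norm_Ad_of_unitary ((unitaryUnits _).inv_mem hbu)]
  have h := (norm_sideDeriv_sub_lin_le L hL hW ψ q κ hw hWw).2
  refine h.trans (add_le_add (mul_le_mul_of_nonneg_left (loopAvg_le_loopL1 L hW ψ q κ) (by norm_num)) (norm_dhol_le hW ψ _ _))

/-- **THE LINEARISED AVERAGE AT A NEAR-IDENTITY BACKGROUND IS `T_c` UP TO `O(β + w + b)·ℓ¹`**: for `U(N)` data `W` with loop variables at `c = (q,κ)` within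
`w ≤ 1∕32` of `1`, links starting within `ℓ¹`-distance `(2d+2)L` of `q` within `b` of `1`, and `‖V̄(c) − 1‖ ≤ β`,
`‖pushDir L W ψ (q,κ) − T_c(ψ)‖ ≤ (64β + 1250w + 2(2d+2)L·b)·(loopL1 L ψ q κ + ‖ψ‖_{ℓ¹(Γ_c)})`. [cite: Balaban1985Averaging, (42) p.23, (47)–(48) p.25] -/
theorem norm_pushDir_sub_Tside_le [Nonempty n] {L : ℕ} (hL : 1 ≤ L) {W : Site d → Fin d → (Matrix n n ℂ)ˣ} (hW : IsUnitaryCfg W)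
    (ψ : Site d → Fin d → Matrix n n ℂ) (q : Site d) (κ : Fin d) {b w β : ℝ} (hb : 0 ≤ b) (hw : w ≤ 1 / 32)
    (hWw : ∀ r : Fin d → Fin L, ‖((Wcx L W q κ (boxVec L r) : (Matrix n n ℂ)ˣ) : Matrix n n ℂ) - 1‖ ≤ w)
    (hWb : ∀ (x : Site d) (μ : Fin d), l1 (x - q) ≤ (2 * d + 2) * L → ‖((W x μ : (Matrix n n ℂ)ˣ) : Matrix n n ℂ) - 1‖ ≤ b)
    (hβ : ‖((bavg L W q κ : (Matrix n n ℂ)ˣ) : Matrix n n ℂ) - 1‖ ≤ β) :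
    ‖pushDir L W ψ q κ - Tside L ψ q κ‖
      ≤ (64 * β + 1250 * w + 2 * ((2 * d + 2) * L) * b) * (loopL1 L ψ q κ + lnorm ψ q (seg κ L)) := by
  have hw0 : 0 ≤ w := (norm_nonneg _).trans (hWw fun _ => ⟨0, hL⟩)
  have hβ0 : 0 ≤ β := (norm_nonneg _).trans hβ
  have hW4 : ∀ r : Fin d → Fin L, ‖((Wcx L W q κ (boxVec L r) : (Matrix n n ℂ)ˣ) : Matrix n n ℂ) - 1‖ ≤ 1 / 4 :=
    fun r => (hWw r).trans (hw.trans (by norm_num))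
  have hbu := bavg_mem_unitary L hW q κ hW4
  have hbui : (bavg L W q κ)⁻¹ ∈ unitaryUnits (Matrix n n ℂ) := (unitaryUnits _).inv_mem hbu
  set S := sideDeriv L W ψ q κ with hS
  set Slin := sideDerivLin L W ψ q κ with hSlin
  set F : Matrix n n ℂ := ∑ r : Fin d → Fin L, (((L : ℝ) ^ d)⁻¹ : ℝ) • asum ψ q (loopWord L κ (boxVec L r)) + asum ψ q (seg κ L) with hF
  set A := loopL1 L ψ q κ with hA
  set G := lnorm ψ q (seg κ L) with hG
  have hA0 : 0 ≤ A := loopL1_nonneg L ψ q κ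
  have hG0 : 0 ≤ G := lnorm_nonneg ψ _ _
  -- (a) the conjugation by `V̄(c)⁻¹`
  have hSn : ‖S‖ ≤ 32 * A + G := by
    have h := (norm_sideDeriv_sub_lin_le L hL hW ψ q κ hw hWw).2
    exact h.trans (add_le_add (mul_le_mul_of_nonneg_left (loopAvg_le_loopL1 L hW ψ q κ) (by norm_num)) (norm_dhol_le hW ψ _ _))
  have ha : ‖Ad (bavg L W q κ)⁻¹ S - S‖ ≤ 2 * β * (32 * A + G) := by
    have h := norm_Ad_sub_le hbui S
    have hinv : ‖(((bavg L W q κ)⁻¹ : (Matrix n n ℂ)ˣ) : Matrix n n ℂ) - 1‖ ≤ β :=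
      (norm_inv_sub_one_le (mem_U1_of_unitary hbu)).trans hβ
    calc ‖Ad (bavg L W q κ)⁻¹ S - S‖ ≤ 2 * ‖(((bavg L W q κ)⁻¹ : (Matrix n n ℂ)ˣ) : Matrix n n ℂ) - 1‖ * ‖S‖ := h
      _ ≤ 2 * β * (32 * A + G) := by
          have := mul_le_mul hinv hSn (norm_nonneg _) hβ0
          linarith
  -- (b) the nonlinearity of `J_{X_c}`, `e^{X_c}`
  have hbn : ‖S - Slin‖ ≤ 1250 * w * (A + G) := by
    have h := (norm_sideDeriv_sub_lin_le L hL hW ψ q κ hw hWw).1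
    refine h.trans (mul_le_mul_of_nonneg_left (add_le_add (loopAvg_le_loopL1 L hW ψ q κ) (norm_dhol_le hW ψ _ _)) (by positivity))
  -- (c) the transports
  have hcn : ‖Slin - F‖ ≤ 2 * ((2 * d + 2) * L) * b * A + 2 * L * b * G := norm_sideDerivLin_sub_flat_le L hW ψ q κ hb hWb
  -- (d) the flat identity
  have hFT : F = Tside L ψ q κ := flatLin_eq_Tside hL ψ q κ
  have e1 : pushDir L W ψ q κ - Tside L ψ q κ = (Ad (bavg L W q κ)⁻¹ S - S) + (S - Slin) + (Slin - F) := by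
    rw [← hFT]; simp only [pushDir, ← hS]; abel
  rw [e1]
  have hL1 : (1 : ℝ) ≤ L := by exact_mod_cast hL
  calc ‖(Ad (bavg L W q κ)⁻¹ S - S) + (S - Slin) + (Slin - F)‖
      ≤ ‖Ad (bavg L W q κ)⁻¹ S - S‖ + ‖S - Slin‖ + ‖Slin - F‖ := norm_add₃_le
    _ ≤ 2 * β * (32 * A + G) + 1250 * w * (A + G) + (2 * ((2 * d + 2) * L) * b * A + 2 * L * b * G) := add_le_add (add_le_add ha hbn) hcn
    _ ≤ (64 * β + 1250 * w + 2 * ((2 * d + 2) * L) * b) * (A + G) := by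
        have h1 : 2 * L * b * G ≤ 2 * ((2 * d + 2) * L) * b * G := by
          have : (L : ℝ) ≤ (2 * d + 2) * L := by nlinarith [(Nat.cast_nonneg d : (0:ℝ) ≤ d)]
          have := mul_le_mul_of_nonneg_right (mul_le_mul_of_nonneg_right (mul_le_mul_of_nonneg_left this (by norm_num : (0:ℝ) ≤ 2)) hb) hG0
          linarith
        nlinarith [mul_nonneg hβ0 hG0, mul_nonneg hb hA0, mul_nonneg (mul_nonneg hb hG0) (Nat.cast_nonneg d)]

/-! ## §4 Box currency -/

/-- The loop and segment weights against the `ℓ¹` norm on the box of radius `(2d+2)L` about `q`: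
`loopL1 L ψ q κ + ‖ψ‖_{ℓ¹(Γ_c)} ≤ ((2d+2)L + L)·dirL1 ψ (box ((2d+2)L) q)`. [folklore] -/
theorem loopL1_add_seg_le_box {L : ℕ} (hL : 1 ≤ L) (ψ : Site d → Fin d → Matrix n n ℂ) (q : Site d) (κ : Fin d) :
    loopL1 L ψ q κ + lnorm ψ q (seg κ L) ≤ (((2 * d + 2) * L : ℕ) + L : ℝ) * dirL1 ψ (box ((2 * d + 2) * L) q) := by
  have hD0 := dirL1_nonneg ψ (box ((2 * d + 2) * L) q)
  have hq0 : l1 (q - q) = 0 := by simp [l1]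
  have hloop : ∀ r : Fin d → Fin L, lnorm ψ q (loopWord L κ (boxVec L r)) ≤ (((2 * d + 2) * L : ℕ) : ℝ) * dirL1 ψ (box ((2 * d + 2) * L) q) := by
    intro r
    have hlen := length_loopWord_le L κ r
    have h := lnorm_le_region ψ (z := q) (q := q) (R := (2 * d + 2) * L) (loopWord L κ (boxVec L r)) (by rw [hq0, zero_add]; exact hlen)
    exact h.trans (mul_le_mul_of_nonneg_right (by exact_mod_cast hlen) hD0)
  have hseg : lnorm ψ q (seg κ L) ≤ (L : ℝ) * dirL1 ψ (box ((2 * d + 2) * L) q) := by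
    have hlen : (seg κ (L : ℤ)).length = L := by rw [length_seg, Int.natAbs_natCast]
    have h := lnorm_le_region ψ (z := q) (q := q) (R := (2 * d + 2) * L) (seg κ L) (by rw [hq0, zero_add, hlen]; nlinarith)
    rw [hlen] at h
    exact h
  have hsum : loopL1 L ψ q κ ≤ (((2 * d + 2) * L : ℕ) : ℝ) * dirL1 ψ (box ((2 * d + 2) * L) q) := by
    unfold loopL1
    calc ∑ r : Fin d → Fin L, ((L : ℝ) ^ d)⁻¹ * lnorm ψ q (loopWord L κ (boxVec L r))
        ≤ ∑ _r : Fin d → Fin L, ((L : ℝ) ^ d)⁻¹ * ((((2 * d + 2) * L : ℕ) : ℝ) * dirL1 ψ (box ((2 * d + 2) * L) q)) :=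
          Finset.sum_le_sum fun r _ => mul_le_mul_of_nonneg_left (hloop r) (by positivity)
      _ = (((2 * d + 2) * L : ℕ) : ℝ) * dirL1 ψ (box ((2 * d + 2) * L) q) := by
          rw [← Finset.sum_mul, sum_blockWeight_eq_one L hL, one_mul]
  calc loopL1 L ψ q κ + lnorm ψ q (seg κ L)
      ≤ (((2 * d + 2) * L : ℕ) : ℝ) * dirL1 ψ (box ((2 * d + 2) * L) q) + (L : ℝ) * dirL1 ψ (box ((2 * d + 2) * L) q) := add_le_add hsum hseg
    _ = _ := by ring

/-- **BOX FORM**: `‖pushDir L W ψ (q,κ) − T_c(ψ)‖ ≤ (64β + 1250w + 2(2d+2)L·b)·((2d+2)L + L)·dirL1 ψ (box ((2d+2)L) q)`. [folklore] -/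
theorem norm_pushDir_sub_Tside_le_box [Nonempty n] {L : ℕ} (hL : 1 ≤ L) {W : Site d → Fin d → (Matrix n n ℂ)ˣ} (hW : IsUnitaryCfg W)
    (ψ : Site d → Fin d → Matrix n n ℂ) (q : Site d) (κ : Fin d) {b w β : ℝ} (hb : 0 ≤ b) (hw : w ≤ 1 / 32)
    (hWw : ∀ r : Fin d → Fin L, ‖((Wcx L W q κ (boxVec L r) : (Matrix n n ℂ)ˣ) : Matrix n n ℂ) - 1‖ ≤ w)
    (hWb : ∀ (x : Site d) (μ : Fin d), l1 (x - q) ≤ (2 * d + 2) * L → ‖((W x μ : (Matrix n n ℂ)ˣ) : Matrix n n ℂ) - 1‖ ≤ b)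
    (hβ : ‖((bavg L W q κ : (Matrix n n ℂ)ˣ) : Matrix n n ℂ) - 1‖ ≤ β) :
    ‖pushDir L W ψ q κ - Tside L ψ q κ‖
      ≤ (64 * β + 1250 * w + 2 * ((2 * d + 2) * L) * b) * ((((2 * d + 2) * L : ℕ) + L : ℝ) * dirL1 ψ (box ((2 * d + 2) * L) q)) := by
  have hw0 : 0 ≤ w := (norm_nonneg _).trans (hWw fun _ => ⟨0, hL⟩)
  have hβ0 : 0 ≤ β := (norm_nonneg _).trans hβ
  exact (norm_pushDir_sub_Tside_le hL hW ψ q κ hb hw hWw hWb hβ).trans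
    (mul_le_mul_of_nonneg_left (loopL1_add_seg_le_box hL ψ q κ) (by positivity))

/-- **BOX FORM of the size bound**: `‖pushDir L W ψ (q,κ)‖ ≤ 32·((2d+2)L + L)·dirL1 ψ (box ((2d+2)L) q)`. [folklore] -/
theorem norm_pushDir_le_box [Nonempty n] {L : ℕ} (hL : 1 ≤ L) {W : Site d → Fin d → (Matrix n n ℂ)ˣ} (hW : IsUnitaryCfg W)
    (ψ : Site d → Fin d → Matrix n n ℂ) (q : Site d) (κ : Fin d) {w : ℝ} (hw : w ≤ 1 / 32)
    (hWw : ∀ r : Fin d → Fin L, ‖((Wcx L W q κ (boxVec L r) : (Matrix n n ℂ)ˣ) : Matrix n n ℂ) - 1‖ ≤ w) :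
    ‖pushDir L W ψ q κ‖ ≤ 32 * ((((2 * d + 2) * L : ℕ) + L : ℝ) * dirL1 ψ (box ((2 * d + 2) * L) q)) := by
  have h1 := norm_pushDir_le hL hW ψ q κ hw hWw
  have h2 := loopL1_add_seg_le_box hL ψ q κ
  have hG0 : 0 ≤ lnorm ψ q (seg κ L) := lnorm_nonneg ψ _ _
  nlinarith [loopL1_nonneg L ψ q κ]

/-- **THE FLAT `T_c` IN BOX CURRENCY**: `‖T_c(ψ)‖ ≤ (2d+1)L·dirL1 ψ (box ((2d+2)L) q)` (every contour `Γ_{c,x}` has length `≤ 2dL + L`). [folklore] -/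
theorem norm_Tside_le_box {L : ℕ} (hL : 1 ≤ L) (ψ : Site d → Fin d → Matrix n n ℂ) (q : Site d) (κ : Fin d) :
    ‖Tside L ψ q κ‖ ≤ (((2 * d + 1) * L : ℕ) : ℝ) * dirL1 ψ (box ((2 * d + 2) * L) q) := by
  have hD0 := dirL1_nonneg ψ (box ((2 * d + 2) * L) q)
  have hq0 : l1 (q - q) = 0 := by simp [l1]
  unfold Tside
  refine norm_avg_le L hL _ fun r => ?_
  have hlen : (gammaWord L κ (boxVec L r)).length ≤ (2 * d + 1) * L := by
    rw [length_gammaWord]; have := l1_boxVec_le L r; nlinarith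
  have hlen' : (gammaWord L κ (boxVec L r)).length ≤ (2 * d + 2) * L := hlen.trans (by nlinarith)
  have h := lnorm_le_region ψ (z := q) (q := q) (R := (2 * d + 2) * L) (gammaWord L κ (boxVec L r)) (by rw [hq0, zero_add]; exact hlen')
  refine (norm_asum_le_lnorm ψ q _).trans (h.trans ?_)
  exact mul_le_mul_of_nonneg_right (by exact_mod_cast hlen) hD0

end

end Summit.QuantumFields.BalabanUV.T4Continuum.NE7PushDirNearFlat
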